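import Summits.HodgeConjecture.HodgeConjecture.Theorems.R90S6CartanShellSphere   -- ★ p07 W7-i: `latticeGraphIso_apartmentEnum_zero_eq_iff`, `…_eq_latticeGraphIso_iff`, `latticeGraphIso_torusGen_pow_apartmentEnum_zero`, `dist_apartmentEnum_zero_latticeGraphIso_…`
import HarnessLib

/-!
# R90 · S6 «Ch. 14.1–14.5 stable TF» — WAVE 8 card W8-d: THE DICTIONARY «SPHERES = CARTAN DOUBLE COSETS», ELEMENT FORM
# `g K₀ ⊆ K₀ tᵐ K₀ ⟺ dist(𝒪³, g·𝒪³) = 2m` in the `U(3)` lattice tree (`Theorems/R90S6ShellSphereDictU3.lean`)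

Cell `hodgecm-mathlib`, crux H413 (`stmt-HodgeConjecture-24833`), route `HCCMUnconditional`; programme R90-TF, section S6 (base `R90-C14`, dealer
R90-C14-plan (g2)), seat R90-C14-p07 (g0); card **W8-d** of the S6 WAVE 8 sheet `R90/R90-C14-typ2/g2/S6_wave8_targets.v1.b05122f413d1b42e.lean` (typ2 (g2), DEAL #3
«HEADS-E1353.v1»; DAG r5 row E1.3.5.1.3 «SPHERES = CARTAN DOUBLE COSETS»), statement VERBATIM from the sheet (namespace `…R90.S6`, `.Wave8` dropped).
Lane `--kind proof --supports stmt-HodgeConjecture-24833 --as helper`; ONE public theorem; no definition, no instance, no notation, no named fact, no `sorry`;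
imports ★ `Theorems/R90S6CartanShellSphere` (this seat's W7-i: the set-level dictionary `#(K₀ tᵐ K₀ ∕ K₀) = #S_{2m}(𝒪³)` and its lemmas) + HarnessLib.

THE MATHEMATICS [BruhatTits1972, §10, (4.4.3); Serre, *Trees* II.1.1; Tits1979, §3.3.3].  `K` a discretely valued field with the unramified datum
`hd : UnramifiedLocalConjDatum σ ϖ`, `U = U(σ, J₀)(K)`, `K₀ = unitaryInt σ J₀`, `t = hd.torusGen = diag(ϖ, 1, ϖ⁻¹)`, `x₀` the root vertex `𝒪³` of the lattice tree
`latticeGraph σ ϖ J₀` (any vertex term with `x₀.1 = stdLattice K 3`).  For `g ∈ U` and `m ∈ ℕ`: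
**`g K₀ ∈ K₀ · (tᵐ K₀)` (i.e. `g ∈ K₀ tᵐ K₀`) `⟺ dist(x₀, g · x₀) = 2m`.**  (→) `g K₀ = (k tᵐ) K₀` with `k ∈ K₀`, so `g · x₀ = k · A(2m)` lies at distance `2m`
(★ `dist_apartmentEnum_zero_latticeGraphIso_mul_torusGen_pow`); (←) the root and `g · x₀` lie in one apartment translate `x₀ = u · A 0`, `g · x₀ = u · A j`, `0 ≤ j`
(★ `exists_latticeGraphIso_apartmentEnum_of_isSelfDualLattice`), whence `u ∈ K₀` (★ `latticeGraphIso_apartmentEnum_zero_eq_iff`), `j = 2m` (★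
`dist_apartmentEnum_zero_latticeGraphIso_of_mem_unitaryInt`) and `g K₀ = (u tᵐ) K₀` (★ `latticeGraphIso_apartmentEnum_zero_eq_latticeGraphIso_iff`, ★
`latticeGraphIso_torusGen_pow_apartmentEnum_zero`).  No finiteness, every residue characteristic.
HONEST LABEL: lattice-model bookkeeping; proves no printed global statement, discharges no citation; count-neutral until E1.3.9 consumes it.
HC_CM is proved only modulo the 7 printed citations (2 remaining named inputs: hLiu418 = stmt-HodgeConjecture-24832, h413 = stmt-HodgeConjecture-24833) until rung 0 closes.

## References
* [BruhatTits1972] F. Bruhat, J. Tits, *Groupes réductifs sur un corps local I*, Publ. Math. IHÉS 41 (1972), §10, (4.4.3).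
* [Serre1980Trees] J.-P. Serre, *Trees* (1980), Ch. II §1.1.
* [Tits1979] J. Tits, *Reductive groups over local fields*, PSPM 33.1 (1979), §3.3.3.
-/
set_option autoImplicit false
-- the mandated namespace repeats the single-problem summit's segment (`HodgeConjecture.HodgeConjecture`)
set_option linter.dupNamespace false

noncomputable section

open scoped Valued WithZero Matrix MatrixGroups
open MulAction
open Literature.NumberTheory.Automorphic Literature.NumberTheory.Automorphic.HermitianLattice
open Literature.NumberTheory.Automorphic.UnitaryLatticeTree
open Literature.NumberTheory.Automorphic.CartanUnique (uniformizer_ne_zero)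

namespace Summit.HodgeConjecture.HodgeConjecture.R90.S6

variable {K : Type*} [Field K] [Valued K ℤᵐ⁰] {σ : K →+* K} {ϖ : K}

/-- **W8-d THE DICTIONARY «SPHERES = CARTAN DOUBLE COSETS»** (DAG row E1.3.5.1.3): for the root vertex `x₀ = L₀ = 𝒪³` and `g ∈ U(σ, J₀)(K)`,
`g K₀ ⊆ K₀ tᵐ K₀ ⟺ dist(x₀, g·x₀) = 2m` in the lattice tree (W8 sheet b05122f413d1b42e, statement verbatim).  (→) `g K₀ = k tᵐ K₀`, `k ∈ K₀`, and
`(k tᵐ)·x₀ = k·A(2m)` is at distance `2m` (★ `dist_apartmentEnum_zero_latticeGraphIso_mul_torusGen_pow`); (←) place `(x₀, g·x₀) = u·(A 0, A j)` (★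
`exists_latticeGraphIso_apartmentEnum_of_isSelfDualLattice`), read `u ∈ K₀`, `j = 2m`, `g K₀ = u tᵐ K₀`. [cite: BruhatTits1972, §10, (4.4.3)] [cite: Serre1980Trees, II.1.1]
[cite: Tits1979, §3.3.3] -/
theorem mem_orbit_torusGen_pow_iff_dist_eq_three (hd : UnramifiedLocalConjDatum σ ϖ)
    (x₀ : {M : Submodule 𝒪[K] (Fin 3 → K) // IsVertex σ ϖ ((StdForm.antidiagonal 3).over K) M}) (hx₀ : x₀.1 = stdLattice K 3)
    (g : unitaryGroupOfForm σ ((StdForm.antidiagonal 3).over K)) (m : ℕ) :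
    (g : unitaryGroupOfForm σ ((StdForm.antidiagonal 3).over K) ⧸ unitaryInt σ ((StdForm.antidiagonal 3).over K)) ∈
        MulAction.orbit (unitaryInt σ ((StdForm.antidiagonal 3).over K))
          ((hd.torusGen ^ m : unitaryGroupOfForm σ ((StdForm.antidiagonal 3).over K)) :
            unitaryGroupOfForm σ ((StdForm.antidiagonal 3).over K) ⧸ unitaryInt σ ((StdForm.antidiagonal 3).over K)) ↔
      (latticeGraph σ ϖ ((StdForm.antidiagonal 3).over K)).dist x₀
          (latticeGraphPerm σ ϖ ((StdForm.antidiagonal 3).over K) g x₀) = 2 * m := by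
  obtain ⟨A, hA0, hA1⟩ := exists_apartmentEnum hd
  -- the root of the sheet is the apartment vertex `A 0`
  obtain rfl : x₀ = A 0 := Subtype.ext (by rw [hx₀, coe_apartmentEnum_zero A hA0])
  change _ ↔ (latticeGraph σ ϖ ((StdForm.antidiagonal 3).over K)).dist (A 0) (latticeGraphIso σ ϖ ((StdForm.antidiagonal 3).over K) g (A 0)) = 2 * m
  constructor
  · -- (→) `g K₀ = k tᵐ K₀` with `k ∈ K₀`
    intro hg
    obtain ⟨k, hk⟩ := MulAction.mem_orbit_iff.1 hg
    have hk' : (((k : ↥(unitaryGroupOfForm σ ((StdForm.antidiagonal 3).over K))) * hd.torusGen ^ m :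
          ↥(unitaryGroupOfForm σ ((StdForm.antidiagonal 3).over K))) :
        ↥(unitaryGroupOfForm σ ((StdForm.antidiagonal 3).over K)) ⧸ unitaryInt σ ((StdForm.antidiagonal 3).over K)) = g := hk
    rw [← (latticeGraphIso_apartmentEnum_zero_eq_latticeGraphIso_iff A hA0 _ _).2 hk']
    exact dist_apartmentEnum_zero_latticeGraphIso_mul_torusGen_pow hd A hA0 hA1 k.2 m
  · -- (←) place the root and `g · root` in one apartment translate
    intro h
    have hA : IsSelfDualLattice σ ϖ ((StdForm.antidiagonal 3).over K) (A 0).1 := by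
      rw [coe_apartmentEnum_zero A hA0]; exact isSelfDualLattice_stdLattice_three_of_v hd.vϖ
    obtain ⟨u, j, hj, hx, hgu⟩ := exists_latticeGraphIso_apartmentEnum_of_isSelfDualLattice hd A hA0 hA1 hA
      (latticeGraphIso σ ϖ ((StdForm.antidiagonal 3).over K) g (A 0))
    have hu : u ∈ unitaryInt σ ((StdForm.antidiagonal 3).over K) := (latticeGraphIso_apartmentEnum_zero_eq_iff A hA0 u).1 hx.symm
    have hj2 : j = 2 * (m : ℤ) := by
      rw [hgu, dist_apartmentEnum_zero_latticeGraphIso_of_mem_unitaryInt hd A hA0 hA1 hu] at h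
      omega
    refine MulAction.mem_orbit_iff.2 ⟨⟨u, hu⟩, ?_⟩
    change (((u * hd.torusGen ^ m : ↥(unitaryGroupOfForm σ ((StdForm.antidiagonal 3).over K)))) :
        ↥(unitaryGroupOfForm σ ((StdForm.antidiagonal 3).over K)) ⧸ unitaryInt σ ((StdForm.antidiagonal 3).over K)) = _
    rw [← latticeGraphIso_apartmentEnum_zero_eq_latticeGraphIso_iff A hA0, hgu, hj2, ← latticeGraphIso_torusGen_pow_apartmentEnum_zero hd A hA0 m]
    apply Subtype.ext
    rw [latticeGraphIso_apply_val, latticeGraphIso_apply_val, latticeGraphIso_apply_val, Subgroup.coe_mul, mapGL_mul]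


end Summit.HodgeConjecture.HodgeConjecture.R90.S6

end
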